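import Mathlib
import HarnessLib

/-!
# Markman 2025 — §5.2 «`Spin(V)`-equivariance of convolutions»: (5.2.1)–(5.2.4), LEMMA 5.2.1 and COROLLARY 5.2.2
# (the conjugate spin representation `m† := τmτ`, the `m† × m`-invariance of the Poincaré pairing, and the
# equivariance of correspondence homomorphisms `γ ↦ γ_*`) — the linear algebra AS PRINTED (v2 p. 29 L3 – p. 30 L34),
# kernel-checked

E. Markman: [M] *Cycles on abelian 2n-folds of Weil type from secant sheaves on abelian n-folds*,
arXiv:2502.03415 **v2** (2025-06-08), bib `Markman2025SecantWeil` — UNREFEREED PREPRINT. «p. N L m» = PyMuPDF line `m`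
of page `N` of the public v2 PDF (sha256/16 `8155aa33870069b8`), read at seat lit-w-markman g22 (pub-hsemireg LIT-W,
2026-08-25; §5.2 from the numbered text layer, p. 29 and p. 30 L3–34 re-read BY EYE on the renders
`r_mar25v2_p29_sec52.png`, `r_mar25v2_p30_lemma521_cor522.png` in `HOME/lit/Markman-renders-litw-markman-g22/`; sheet
`LOCATOR-SHEET-MARKMAN.md` §68). §5.2 is the bookkeeping behind the `m ⊗ m†`-action under which Orlov's equivalence
`Φ` is `Spin(V)`-equivariant (§6.1, Prop. 6.1.2, `ρ′_g := ϕ(m_g × m†_g)ϕ⁻¹` (6.1.4)); `KappaClassInvariance.lean`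
quotes (5.2.1) and takes the equivariance BY VALUE. Rows M-Mk1 ∕ M-Mk9 of the LIT-W table; W1 «derived
autoequivalence orbits» seats.

## What is printed (verbatim; displays linearised)

* (1.2.3), p. 4 L5–13: «The spin representation `S` is endowed with a non-degenerate integral bilinear pairing, which
  is symmetric for even `n` and anti-symmetric for odd `n` (1.2.3) `(s, t)_S := ∫_X τ(s) ∪ t`, where the main
  anti-automorphism `τ` acts via multiplication by `(−1)^{i(i−1)/2}` on `H^i(X, ℤ)`.»
* p. 29 L3–26: «5.2. `Spin(V)`-equivariance of convolutions. … Let `m : Spin(V) → GL(S)` be the Spin representation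
  and denote by (5.2.1) `m† : Spin(V) → GL(S)` the homomorphism `m†_g := τm_gτ`, where `τ` is given in (1.2.3). We
  have (5.2.2) `∫_X m†_g(s) ∪ m_g(t) = (m_g(τ(s)), m_g(t))_S = (τ(s), t)_S = ∫_X s ∪ t`, for all `s, t ∈ S` and
  `g ∈ Spin(V)`, where the second equality follows from the `Spin(V)`-invariance of the Mukai pairing (1.2.3). We
  conclude that the Poincaré pairing is invariant¹⁰ with respect to the action of `Spin(V)` on `S ⊗ S` by
  `g ↦ m†_g × m_g`. Consequently, the Spin-equivariance of the convolution is restored if we let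
  `Spin(V_X) × Spin(V_Y)` act on `H^*(X × Y) = S_X ⊗ S_Y` via `m ⊗ m†` …» — footnote 10: «Equivalently, `m†_{g⁻¹}` is
  the left adjoint of `m_g` with respect to the super-symmetric Poincaré pairing.»
* p. 29 L27–59: «Observe that the following analogue of equality (5.2.2) holds as well. (5.2.3)
  `∫_X m_g(s) ∪ m†_g(t) = ∫_X s ∪ t`, for all classes `s, t ∈ H^*(X)` and all `g ∈ Spin(V)`. Indeed, if `s` and `t` are
  both even, then so are `m_g(s)` and `m†_g(t)` and the above follows from (5.2.2) and the symmetry of the Poincaré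
  pairing on even cohomology, if `s` and `t` are both odd, then so are `m_g(s)` and `m†_g(t)` and
  `∫_X s ∪ t = −∫_X t ∪ s =(5.2.2) −∫_X m†_g(t) ∪ m_g(s) = ∫_X m_g(s) ∪ m†_g(t)`, and if one is odd and the other even,
  then both sides of (5.2.3) vanish.»
* p. 29 L60–75: «Let `PD : H^*(X, ℚ) → H^*(X, ℚ)^*` be given by `PD(s) := ∫_X(• ∪ s)`. Equation (5.2.2) yields
  `PD(m_h(s)) = PD(s) ∘ m†_{h⁻¹}`, for all `h ∈ Spin(V)`.» [commutative square `m_h` ∕ `(•) ∘ m†_{h⁻¹}`]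
* p. 29 L76–89: «Given a class `γ ∈ H^*(X × Y, ℚ)`, let `γ_* : H^*(X) → H^*(Y)` be the associated correspondence
  homomorphism `γ_*(•) := π_{Y,*}(π_X^*(•) ∪ γ)`. LEMMA 5.2.1. The following equalities hold for all `h ∈ Spin(V_X)`
  and `g ∈ Spin(V_Y)`. `[(m_h ⊗ m†_g)(γ)]_* = m†_g ∘ γ_* ∘ m†_{h⁻¹}`, (5.2.4) `[(m†_h ⊗ m_g)(γ)]_* = m_g ∘ γ_* ∘ m_{h⁻¹}`.»
* p. 30 L3–22: «Note that Equation (5.2.4) establishes the `Spin(V_X) × Spin(V_Y)`-equivariance of the map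
  `H^*(X × Y, ℚ) → Hom(H^*(X, ℚ), H^*(Y, ℚ))` sending `γ` to `γ_*` with respect to the `m† × m` on the domain and the
  usual action on the target. Proof. We prove the first equality. Let `{u_i}` be a basis of `H^*(X, ℚ)` and `{v_j}` a
  basis for `H^*(Y, ℚ)`. Write `γ := Σ a_ij u_i ⊗ v_j`. Then `γ_*(•) = Σ a_ij PD(u_i) ⊗ v_j`. We get
  `[(m_h ⊗ 1)(γ)]_* = Σ a_ij PD(m_h(u_i)) ⊗ v_j =(5.2.2) Σ a_ij (PD(u_i) ∘ m†_{h⁻¹}) ⊗ v_j = γ_* ∘ m†_{h⁻¹}(•)`. The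
  identity `(1 ⊗ m†_g)(γ) = m†_g ∘ γ_*` is evident, for all `g ∈ Spin(V_Y)`. The proof of the second equality (5.2.4)
  is identical, using Equation (5.2.3) instead of (5.2.2).»
* p. 30 L23–34: «Let `γ ∈ H^*(X × Y, ℚ)` and `δ ∈ H^*(Y × Z, ℚ)`. The following `Spin(V_Y)`-invariance of composition
  of correspondence homomorphisms is an immediate corollary of Lemma 5.2.1. COROLLARY 5.2.2. The following equalities
  hold for all `h ∈ Spin(V_Y)`. `[(m_h ⊗ 1)(δ)]_* ∘ [(1 ⊗ m†_h)(γ)]_* = δ_* ∘ γ_*`,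
  `[(m†_h ⊗ 1)(δ)]_* ∘ [(1 ⊗ m_h)(γ)]_* = δ_* ∘ γ_*`.»

## The model and what is proved (0 `def`, 0 named fact, 0 sorry; finite-free linear algebra only)

`R` a commutative ring (`ℤ`, `ℚ`), `S`, `S_X`, `S_Y`, `S_Z` `R`-modules («`H^*(X)`» …), `G` a group («`Spin(V)`»),
`m, m† : Representation R G S` (Mathlib: monoid homs `G →* End_R S`). The printed DEFINITIONS enter as named
hypotheses on otherwise arbitrary data (so that nothing is declared): `hτ : τ(τ s) = s` (the involution (1.2.3));
`hP : P s t = μ(τ s, t)` (the Poincaré pairing `P(s, t) = ∫_X s ∪ t` versus the Mukai pairing `μ = (•, •)_S`, i.e.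
(1.2.3) read as `∫ s ∪ t = (τ s, t)_S` using `τ² = 1`); `hμ : μ(m_g s, m_g t) = μ(s, t)` («the `Spin(V)`-invariance of
the Mukai pairing»); `hmd : m†_g s = τ(m_g(τ s))` ((5.2.1)); `PD = P.flip` (`PD(s) = ∫(• ∪ s)`); the correspondence
homomorphism is any `corr : S_X ⊗ S_Y →ₗ (S_X →ₗ S_Y)` with `hcorr : corr(u ⊗ v)(x) = P(x, u)·v` — the printed
«`γ_*(•) = Σ a_ij PD(u_i) ⊗ v_j`» for `γ = Σ a_ij u_i ⊗ v_j` (`corr_model`: Mathlib's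
`TensorProduct.lift (smulRightₗ ∘ P.flip)` is such a `corr`), and `(m_h ⊗ m†_g)(γ)` is `TensorProduct.map (m h) (m† g) γ`.
The SUPER-SYMMETRY used for (5.2.3) («symmetric on even … `∫ s ∪ t = −∫ t ∪ s` on odd … both sides vanish if one is
odd and the other even») is encoded by the parity involution `ι = (−1)^{deg}`: `hss : P(s, t) = P(t, ι s)` together with
`hι : m_g ∘ ι = ι ∘ m_g` («then so are `m_g(s)` and `m†_g(t)`» even ∕ odd); `ss_even`, `ss_odd`, `ss_mixed` recover the
three printed cases from `hss`.
THEOREMS. §A: `mdag_mul`, `mdag_one` ((5.2.1) is a homomorphism since `τ² = 1`), `eq522` ((5.2.2) DERIVED from `hτ`,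
`hP`, `hμ`, `hmd`); §B: `eq523` ((5.2.3) from (5.2.2) + `hss` + `hι`), `ss_even` ∕ `ss_odd` ∕ `ss_mixed`; §C: `rep_inv_apply`,
`PD_conj` («`PD(m_h(s)) = PD(s) ∘ m†_{h⁻¹}`», from (5.2.2)), `footnote10` (`P(m†_{g⁻¹} x, u) = P(x, m_g u)`), `PD_conj'`
(the (5.2.3)-analogue `P(x, m†_h u) = P(m_{h⁻¹} x, u)`); §D LEMMA 5.2.1: `corr_map_left` («`[(m_h ⊗ 1)(γ)]_* = γ_* ∘
m†_{h⁻¹}`»), `corr_map_right` («`(1 ⊗ m†_g)(γ) ↦ m†_g ∘ γ_*` is evident» — for ANY endomorphism on the right),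
`lemma521_first`, `lemma521_second` ((5.2.4)); §E COROLLARY 5.2.2: `cor522_first`, `cor522_second`.
BY VALUE ∕ NOT modelled: cohomology, `∫_X`, `π_{Y,*}`, `π_X^*`, gradings and Koszul signs (absorbed in `hcorr` exactly as
in the printed «`γ_*(•) = Σ a_ij PD(u_i) ⊗ v_j`»), `Spin(V)`, `GL(S)`, bases (the proof's `Σ a_ij u_i ⊗ v_j` is
Mathlib's induction on tensors), Remark 5.2.3, the convolution `F ∗ G` and §5.1. This file re-proves no geometric
statement of [M]; nothing here says any object is semiregular or that HC ∕ HC_CM ∕ HC_AV is proved.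
-/

namespace Literature.AlgebraicGeometry.Markman2025.Convolution52

open TensorProduct

variable {R : Type*} [CommRing R]
variable {S : Type*} [AddCommGroup S] [Module R S]
variable {G : Type*} [Group G]

/-! ### §A — (5.2.1) `m†_g := τm_gτ` and (5.2.2) `∫ m†_g(s) ∪ m_g(t) = ∫ s ∪ t` -/

/-- (5.2.1) «denote by `m† : Spin(V) → GL(S)` the homomorphism `m†_g := τm_gτ`» — it IS multiplicative because
`τ² = 1`: `τm_{gh}τ = (τm_gτ)(τm_hτ)`. [cite: Markman2025SecantWeil, (5.2.1), p. 29 L6–10] -/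
theorem mdag_mul (τ : S →ₗ[R] S) (hτ : ∀ s, τ (τ s) = s) (m : Representation R G S) (g h : G) :
    τ ∘ₗ m (g * h) ∘ₗ τ = (τ ∘ₗ m g ∘ₗ τ) ∘ₗ (τ ∘ₗ m h ∘ₗ τ) := by
  ext s
  simp [map_mul, Module.End.mul_apply, hτ]

/-- … and unital: `τm_1τ = τ²  = 1`. [cite: Markman2025SecantWeil, (5.2.1), p. 29 L6–10] -/
theorem mdag_one (τ : S →ₗ[R] S) (hτ : ∀ s, τ (τ s) = s) (m : Representation R G S) :
    τ ∘ₗ m 1 ∘ₗ τ = LinearMap.id := by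
  ext s
  simp [map_one, hτ]

/-- **(5.2.2)** «`∫_X m†_g(s) ∪ m_g(t) = (m_g(τ(s)), m_g(t))_S = (τ(s), t)_S = ∫_X s ∪ t` … where the second equality
follows from the `Spin(V)`-invariance of the Mukai pairing (1.2.3)» — DERIVED: with `P(s, t) = ∫ s ∪ t = μ(τ s, t)`
(`hP`, i.e. (1.2.3) and `τ² = 1`), `μ` `m`-invariant (`hμ`) and `m†_g = τm_gτ` (`hmd`).
[cite: Markman2025SecantWeil, (5.2.2), p. 29 L10–22] -/
theorem eq522 (τ : S →ₗ[R] S) (hτ : ∀ s, τ (τ s) = s) (μ P : S →ₗ[R] S →ₗ[R] R) (hP : ∀ s t, P s t = μ (τ s) t)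
    (m md : Representation R G S) (hμ : ∀ g s t, μ (m g s) (m g t) = μ s t)
    (hmd : ∀ g s, md g s = τ (m g (τ s))) (g : G) (s t : S) :
    P (md g s) (m g t) = P s t := by
  rw [hP, hmd, hτ, hμ, ← hP]

/-! ### §B — (5.2.3) `∫ m_g(s) ∪ m†_g(t) = ∫ s ∪ t` from (5.2.2) and super-symmetry -/

/-- **(5.2.3)** «the following analogue of equality (5.2.2) holds as well … `∫_X m_g(s) ∪ m†_g(t) = ∫_X s ∪ t`» — from
(5.2.2) (`h522`) and the super-symmetry of `P` in the parity-involution form `P(s, t) = P(t, ι s)` (`hss`,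
`ι = (−1)^{deg}`), `m_g` parity-preserving (`hι`): `P(m_g s, m†_g t) = P(m†_g t, ι m_g s) = P(m†_g t, m_g ι s) =
P(t, ι s) = P(s, t)` — the printed even ∕ odd ∕ mixed trichotomy in one line.
[cite: Markman2025SecantWeil, (5.2.3), p. 29 L27–59] -/
theorem eq523 (P : S →ₗ[R] S →ₗ[R] R) (ι : S →ₗ[R] S) (hss : ∀ s t, P s t = P t (ι s))
    (m md : Representation R G S) (hι : ∀ g s, m g (ι s) = ι (m g s))
    (h522 : ∀ g s t, P (md g s) (m g t) = P s t) (g : G) (s t : S) :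
    P (m g s) (md g t) = P s t := by
  rw [hss, ← hι, h522, ← hss]

/-- The printed case «if `s` and `t` are both even … the symmetry of the Poincaré pairing on even cohomology»:
`ι s = s` gives `P(s, t) = P(t, s)`. [cite: Markman2025SecantWeil, (5.2.3) proof, p. 29 L36–39] -/
theorem ss_even (P : S →ₗ[R] S →ₗ[R] R) (ι : S →ₗ[R] S) (hss : ∀ s t, P s t = P t (ι s)) {s : S}
    (hs : ι s = s) (t : S) : P s t = P t s := by
  rw [hss, hs]

/-- The printed case «if `s` and `t` are both odd … `∫_X s ∪ t = −∫_X t ∪ s`»: `ι s = −s` gives `P(s, t) = −P(t, s)`.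
[cite: Markman2025SecantWeil, (5.2.3) proof, p. 29 L39–58] -/
theorem ss_odd (P : S →ₗ[R] S →ₗ[R] R) (ι : S →ₗ[R] S) (hss : ∀ s t, P s t = P t (ι s)) {s : S}
    (hs : ι s = -s) (t : S) : P s t = -P t s := by
  rw [hss, hs, map_neg]

/-- The printed case «if one is odd and the other even, then both sides of (5.2.3) vanish»: `ι s = s`, `ι t = −t`
give `2·P(s, t) = 0` (hence `P(s, t) = 0` when `2` is a non-zero-divisor on `R`, e.g. `R = ℤ, ℚ`).
[cite: Markman2025SecantWeil, (5.2.3) proof, p. 29 L59] -/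
theorem ss_mixed (P : S →ₗ[R] S →ₗ[R] R) (ι : S →ₗ[R] S) (hss : ∀ s t, P s t = P t (ι s)) {s t : S}
    (hs : ι s = s) (ht : ι t = -t) : 2 * P s t = 0 := by
  have h1 : P s t = P t s := by rw [hss, hs]
  have h2 : P t s = -P s t := by rw [hss t s, ht, map_neg]
  rw [two_mul]
  nth_rewrite 1 [h1, h2]
  exact neg_add_cancel (P s t)

/-- … so over `ℤ` or `ℚ` (no `2`-torsion) the mixed pairing vanishes.
[cite: Markman2025SecantWeil, (5.2.3) proof, p. 29 L59] -/
theorem ss_mixed_eq_zero [NoZeroDivisors R] (h2 : (2 : R) ≠ 0) (P : S →ₗ[R] S →ₗ[R] R) (ι : S →ₗ[R] S)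
    (hss : ∀ s t, P s t = P t (ι s)) {s t : S} (hs : ι s = s) (ht : ι t = -t) : P s t = 0 := by
  have := ss_mixed P ι hss hs ht
  rcases mul_eq_zero.mp this with h | h
  · exact absurd h h2
  · exact h

/-! ### §C — `PD(m_h(s)) = PD(s) ∘ m†_{h⁻¹}` and footnote 10 -/

/-- `m_{h⁻¹}(m_h(u)) = u` for a representation (Mathlib bookkeeping used throughout).
[cite: Markman2025SecantWeil, §5.2, p. 29 L60–64] -/
theorem rep_inv_apply (m : Representation R G S) (h : G) (u : S) : m h⁻¹ (m h u) = u := by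
  rw [← Module.End.mul_apply, ← map_mul, inv_mul_cancel, map_one, Module.End.one_apply]

/-- `m_h(m_{h⁻¹}(u)) = u`. [cite: Markman2025SecantWeil, §5.2, p. 29 L60–64] -/
theorem rep_apply_inv (m : Representation R G S) (h : G) (u : S) : m h (m h⁻¹ u) = u := by
  rw [← Module.End.mul_apply, ← map_mul, mul_inv_cancel, map_one, Module.End.one_apply]

/-- «Let `PD : H^*(X, ℚ) → H^*(X, ℚ)^*` be given by `PD(s) := ∫_X(• ∪ s)`. Equation (5.2.2) yields
`PD(m_h(s)) = PD(s) ∘ m†_{h⁻¹}`» — `PD = P.flip`; pointwise `P(x, m_h u) = P(m†_{h⁻¹} x, u)` ((5.2.2) at `g = h⁻¹`).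
[cite: Markman2025SecantWeil, §5.2, p. 29 L60–75] -/
theorem PD_conj (P : S →ₗ[R] S →ₗ[R] R) (m md : Representation R G S)
    (h522 : ∀ g s t, P (md g s) (m g t) = P s t) (h : G) (u : S) :
    P.flip (m h u) = P.flip u ∘ₗ md h⁻¹ := by
  ext x
  simp only [LinearMap.flip_apply, LinearMap.coe_comp, Function.comp_apply]
  rw [← h522 h⁻¹ x (m h u), rep_inv_apply]

/-- Footnote 10: «Equivalently, `m†_{g⁻¹}` is the left adjoint of `m_g` with respect to the super-symmetric Poincaré
pairing»: `P(m†_{g⁻¹} x, u) = P(x, m_g u)`. [cite: Markman2025SecantWeil, §5.2 footnote 10, p. 29 L91–92] -/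
theorem footnote10 (P : S →ₗ[R] S →ₗ[R] R) (m md : Representation R G S)
    (h522 : ∀ g s t, P (md g s) (m g t) = P s t) (g : G) (x u : S) :
    P (md g⁻¹ x) u = P x (m g u) := by
  rw [← h522 g⁻¹ x (m g u), rep_inv_apply]

/-- The (5.2.3)-analogue used for the second equality of (5.2.4): `P(x, m†_h u) = P(m_{h⁻¹} x, u)`.
[cite: Markman2025SecantWeil, proof of Lemma 5.2.1, p. 30 L20–22] -/
theorem PD_conj' (P : S →ₗ[R] S →ₗ[R] R) (m md : Representation R G S)
    (h523 : ∀ g s t, P (m g s) (md g t) = P s t) (h : G) (x u : S) :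
    P x (md h u) = P (m h⁻¹ x) u := by
  rw [← h523 h⁻¹ x (md h u), rep_inv_apply]

/-! ### §D — LEMMA 5.2.1: `γ_*` and its equivariance (5.2.4) -/

section Correspondence

variable {SX : Type*} [AddCommGroup SX] [Module R SX]
variable {SY : Type*} [AddCommGroup SY] [Module R SY]
variable {SZ : Type*} [AddCommGroup SZ] [Module R SZ]

/-- The printed «Write `γ := Σ a_ij u_i ⊗ v_j`. Then `γ_*(•) = Σ a_ij PD(u_i) ⊗ v_j`» IS realizable: Mathlib's
`TensorProduct.lift (smulRightₗ ∘ P.flip)` sends `u ⊗ v` to `x ↦ P(x, u)·v = PD(u)(x)·v` (so every `hcorr` below is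
satisfiable, linearly in `γ`). [cite: Markman2025SecantWeil, proof of Lemma 5.2.1, p. 30 L6–7] -/
theorem corr_model (P : SX →ₗ[R] SX →ₗ[R] R) (u : SX) (v : SY) (x : SX) :
    TensorProduct.lift ((LinearMap.smulRightₗ : (SX →ₗ[R] R) →ₗ[R] SY →ₗ[R] SX →ₗ[R] SY) ∘ₗ P.flip) (u ⊗ₜ v) x
      = P x u • v := by
  simp [TensorProduct.lift.tmul, LinearMap.smulRightₗ_apply]

variable (P : SX →ₗ[R] SX →ₗ[R] R) (corr : SX ⊗[R] SY →ₗ[R] (SX →ₗ[R] SY))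

/-- «`[(m_h ⊗ 1)(γ)]_* = Σ a_ij PD(m_h(u_i)) ⊗ v_j =(5.2.2) Σ a_ij (PD(u_i) ∘ m†_{h⁻¹}) ⊗ v_j = γ_* ∘ m†_{h⁻¹}(•)`»
(induction on the tensor `γ` replaces the basis expansion).
[cite: Markman2025SecantWeil, proof of Lemma 5.2.1, p. 30 L6–16] -/
theorem corr_map_left (hcorr : ∀ u v x, corr (u ⊗ₜ v) x = P x u • v) (m md : Representation R G SX)
    (h522 : ∀ g s t, P (md g s) (m g t) = P s t) (h : G) (γ : SX ⊗[R] SY) :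
    corr (TensorProduct.map (m h) LinearMap.id γ) = corr γ ∘ₗ md h⁻¹ := by
  induction γ using TensorProduct.induction_on with
  | zero => simp
  | tmul u v =>
    ext x
    rw [TensorProduct.map_tmul, LinearMap.id_apply, hcorr, LinearMap.comp_apply, hcorr,
      footnote10 P m md h522]
  | add a b ha hb => simp only [map_add, ha, hb, LinearMap.add_comp]

/-- «The identity `(1 ⊗ m†_g)(γ) = m†_g ∘ γ_*` is evident, for all `g ∈ Spin(V_Y)`» — indeed for ANY endomorphism
`f` of the right factor: `[(1 ⊗ f)(γ)]_* = f ∘ γ_*`. [cite: Markman2025SecantWeil, proof of Lemma 5.2.1, p. 30 L17–19] -/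
theorem corr_map_right (hcorr : ∀ u v x, corr (u ⊗ₜ v) x = P x u • v) (f : SY →ₗ[R] SY) (γ : SX ⊗[R] SY) :
    corr (TensorProduct.map LinearMap.id f γ) = f ∘ₗ corr γ := by
  induction γ using TensorProduct.induction_on with
  | zero => simp
  | tmul u v =>
    ext x
    rw [TensorProduct.map_tmul, LinearMap.id_apply, hcorr, LinearMap.comp_apply, hcorr, map_smul]
  | add a b ha hb => simp only [map_add, ha, hb, LinearMap.comp_add]

/-- **LEMMA 5.2.1, first equality**: «`[(m_h ⊗ m†_g)(γ)]_* = m†_g ∘ γ_* ∘ m†_{h⁻¹}`» for `h ∈ Spin(V_X)` (acting on `S_X`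
by `m`, `m†` with (5.2.2)) and `g ∈ Spin(V_Y)` (acting on `S_Y` by `m†`, here `mdY`).
[cite: Markman2025SecantWeil, Lemma 5.2.1 (5.2.4), p. 29 L79–85; proof p. 30 L6–19] -/
theorem lemma521_first (hcorr : ∀ u v x, corr (u ⊗ₜ v) x = P x u • v) (m md : Representation R G SX)
    (h522 : ∀ g s t, P (md g s) (m g t) = P s t) {GY : Type*} [Group GY] (mdY : Representation R GY SY)
    (h : G) (g : GY) (γ : SX ⊗[R] SY) :
    corr (TensorProduct.map (m h) (mdY g) γ) = mdY g ∘ₗ corr γ ∘ₗ md h⁻¹ := by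
  have hsplit : TensorProduct.map (m h) (mdY g) =
      TensorProduct.map LinearMap.id (mdY g) ∘ₗ TensorProduct.map (m h) LinearMap.id := by
    rw [← TensorProduct.map_comp, LinearMap.id_comp, LinearMap.comp_id]
  rw [hsplit, LinearMap.comp_apply, corr_map_right P corr hcorr, corr_map_left P corr hcorr m md h522]

/-- **LEMMA 5.2.1, second equality (5.2.4)**: «`[(m†_h ⊗ m_g)(γ)]_* = m_g ∘ γ_* ∘ m_{h⁻¹}`» — «The proof … is identical,
using Equation (5.2.3) instead of (5.2.2)» (`h523`).
[cite: Markman2025SecantWeil, Lemma 5.2.1 (5.2.4), p. 29 L86–90; proof p. 30 L20–22] -/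
theorem lemma521_second (hcorr : ∀ u v x, corr (u ⊗ₜ v) x = P x u • v) (m md : Representation R G SX)
    (h523 : ∀ g s t, P (m g s) (md g t) = P s t) {GY : Type*} [Group GY] (mY : Representation R GY SY)
    (h : G) (g : GY) (γ : SX ⊗[R] SY) :
    corr (TensorProduct.map (md h) (mY g) γ) = mY g ∘ₗ corr γ ∘ₗ m h⁻¹ := by
  have hleft : corr (TensorProduct.map (md h) LinearMap.id γ) = corr γ ∘ₗ m h⁻¹ := by
    induction γ using TensorProduct.induction_on with
    | zero => simp
    | tmul u v =>
      ext x
      rw [TensorProduct.map_tmul, LinearMap.id_apply, hcorr, LinearMap.comp_apply, hcorr,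
        PD_conj' P m md h523]
    | add a b ha hb => simp only [map_add, ha, hb, LinearMap.add_comp]
  have hsplit : TensorProduct.map (md h) (mY g) =
      TensorProduct.map LinearMap.id (mY g) ∘ₗ TensorProduct.map (md h) LinearMap.id := by
    rw [← TensorProduct.map_comp, LinearMap.id_comp, LinearMap.comp_id]
  rw [hsplit, LinearMap.comp_apply, corr_map_right P corr hcorr, hleft]

/-! ### §E — COROLLARY 5.2.2: `Spin(V_Y)`-invariance of composition of correspondences -/

variable (PY : SY →ₗ[R] SY →ₗ[R] R) (corrYZ : SY ⊗[R] SZ →ₗ[R] (SY →ₗ[R] SZ))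

/-- **COROLLARY 5.2.2, first equality**: «`[(m_h ⊗ 1)(δ)]_* ∘ [(1 ⊗ m†_h)(γ)]_* = δ_* ∘ γ_*`» for `γ ∈ H^*(X × Y)`,
`δ ∈ H^*(Y × Z)`, `h ∈ Spin(V_Y)` (acting on `S_Y` by `m`, `m†` with (5.2.2) for the pairing `P_Y` defining `δ_*`):
`(δ_* ∘ m†_{h⁻¹}) ∘ (m†_h ∘ γ_*) = δ_* ∘ γ_*`. [cite: Markman2025SecantWeil, Cor. 5.2.2, p. 30 L23–30] -/
theorem cor522_first (hcorr : ∀ u v x, corr (u ⊗ₜ v) x = P x u • v)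
    (hcorrYZ : ∀ v w y, corrYZ (v ⊗ₜ w) y = PY y v • w) (mY mdY : Representation R G SY)
    (h522Y : ∀ g s t, PY (mdY g s) (mY g t) = PY s t) (h : G) (γ : SX ⊗[R] SY) (δ : SY ⊗[R] SZ) :
    corrYZ (TensorProduct.map (mY h) LinearMap.id δ) ∘ₗ corr (TensorProduct.map LinearMap.id (mdY h) γ)
      = corrYZ δ ∘ₗ corr γ := by
  rw [corr_map_left PY corrYZ hcorrYZ mY mdY h522Y, corr_map_right P corr hcorr]
  ext x
  simp only [LinearMap.coe_comp, Function.comp_apply, rep_inv_apply]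

/-- **COROLLARY 5.2.2, second equality**: «`[(m†_h ⊗ 1)(δ)]_* ∘ [(1 ⊗ m_h)(γ)]_* = δ_* ∘ γ_*`» (via (5.2.3) for `P_Y`):
`(δ_* ∘ m_{h⁻¹}) ∘ (m_h ∘ γ_*) = δ_* ∘ γ_*`. [cite: Markman2025SecantWeil, Cor. 5.2.2, p. 30 L26–34] -/
theorem cor522_second (hcorr : ∀ u v x, corr (u ⊗ₜ v) x = P x u • v)
    (hcorrYZ : ∀ v w y, corrYZ (v ⊗ₜ w) y = PY y v • w) (mY mdY : Representation R G SY)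
    (h523Y : ∀ g s t, PY (mY g s) (mdY g t) = PY s t) (h : G) (γ : SX ⊗[R] SY) (δ : SY ⊗[R] SZ) :
    corrYZ (TensorProduct.map (mdY h) LinearMap.id δ) ∘ₗ corr (TensorProduct.map LinearMap.id (mY h) γ)
      = corrYZ δ ∘ₗ corr γ := by
  have hleft : corrYZ (TensorProduct.map (mdY h) LinearMap.id δ) = corrYZ δ ∘ₗ mY h⁻¹ := by
    induction δ using TensorProduct.induction_on with
    | zero => simp
    | tmul v w =>
      ext y
      rw [TensorProduct.map_tmul, LinearMap.id_apply, hcorrYZ, LinearMap.comp_apply, hcorrYZ,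
        PD_conj' PY mY mdY h523Y]
    | add a b ha hb => simp only [map_add, ha, hb, LinearMap.add_comp]
  rw [hleft, corr_map_right P corr hcorr]
  ext x
  simp only [LinearMap.coe_comp, Function.comp_apply, rep_inv_apply]

end Correspondence

end Literature.AlgebraicGeometry.Markman2025.Convolution52
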